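import Literature.AlgebraicGeometry.Resolution.StrictTransformOpenImmersion
import Mathlib.AlgebraicGeometry.Morphisms.Proper
import HarnessLib

/-!
# Extending `V → U` to a proper morphism from an open of a compactification of `V`
# (Stacks 0F3Z, conditional on Raynaud–Gruson flattening)

Topic: `Literature/AlgebraicGeometry/Morphisms`. The Stacks Project, Tag 0F3Z (More on Flatness,
Lemma 38.33.6): "Let `S` be a quasi-compact and quasi-separated scheme. Let `U` be a scheme of
finite type and separated over `S`. Let `V ⊂ U` be a quasi-compact open. If `V` has a
compactification `V ⊂ Y` over `S`, then there exists a `V`-admissible blowing up `Y' → Y` and an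
open `V ⊂ V' ⊂ Y'` such that `V → U` extends to a proper morphism `V' → U`." This is the first
step of the two-piece induction (Tag 0F40) in the Stacks Project's proof of Nagata's
compactification theorem (Tag 0F41; the named fact
`Literature.AlgebraicGeometry.Morphisms.NagataCompactification`).

PROVED, conditionally on the named fact `Resolution.Stacks081R` (Raynaud–Gruson flattening, the
only undischarged input, entering through Tag 081S = `Resolution.stacks081S_of_stacks081R`),
following the printed proof: "Consider the scheme theoretic image `Z ⊂ Y ×_S U` of the 'diagonal'
morphism `V → Y ×_S U`. If we replace `Y` by a `V`-admissible blowing up, then `Z` is replaced by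
the strict transform with respect to this blowing up, see Lemma 0F3Y. Hence by Lemma 081S we may
assume `Z → Y` is an open immersion. If `V' ⊂ Y` denotes the image, then we see that the induced
morphism `V' → U` is proper because the projection `Y ×_S U → U` is proper and `V' ≅ Z` is a
closed subscheme of `Y ×_S U`." We do not need Lemma 0F3Y as a separate statement: we apply
Tag 081S to `Z → Y` (an isomorphism over `V`, by the graph-closure lemma
`GraphClosure.isIso_morphismRestrict`, Stacks 01RH) and work directly with the strict transform
`Z'` of `Z`, an open `V' ≅ Z'` of the blown-up `Y'`: `V' → U` is `Z' → Z ×_Y Y' → Z → Y ×_S U → U`,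
a composite of proper morphisms, `V` sits in `V'` through `(V → Z, V → Y') : V → Z ×_Y Y'`, which
lands in the open over `V` where the strict transform is everything, and the restriction of
`V' → U` to `V` is `V → U`. We also record that `V' → U` is an isomorphism over `V ⊆ U` (used in
Tag 0F40: "`ψᵢ` is an isomorphism over an open neighbourhood of `Zᵢ`").

* `Compactification.graph…` — the "diagonal" `γ = (V → Y, V → U) : V → Y ×_S U` and the
  scheme-theoretic image `Z`; `Z → Y` is an isomorphism over `V`, `Z → U` is proper and an
  isomorphism over `V`;
* `stacks0F3Z_of_stacks081R` — **Stacks 0F3Z** (conditional on `Stacks081R`), with the new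
  compactification `Y'` of `V`, the open `V' ⊆ Y'`, the proper `ψ : V' → U` over `S` extending
  `V → U`, and `ψ` an isomorphism over `V`.

## References

* The Stacks Project, Tag 0F3Z (Lemma 38.33.6) and its proof; Tags 081S, 01RH, 0F40.
  [StacksProject]
-/

noncomputable section

-- Mathlib's pull-back API is stated through `abbrev`s over `limit`; as in Mathlib's own
-- algebraic-geometry files we let `simp`/unification see through them.
set_option backward.isDefEq.respectTransparency false

universe u

open CategoryTheory CategoryTheory.Limits AlgebraicGeometry TopologicalSpace
open Literature.AlgebraicGeometry.Resolution

namespace Literature.AlgebraicGeometry.Morphisms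

/-- **Stacks 0F3Z, conditional on Raynaud–Gruson flattening (`Stacks081R`).** Let `S` be
quasi-compact and quasi-separated, `g : U → S` separated and of finite type, `j : V → U` a
quasi-compact open immersion, and `V → Y → S` a compactification of `V` over `S` (`jY` an open
immersion, `πY` proper, `jY ≫ πY = j ≫ g`). Then there are a compactification `V → Y' → S` of `V`
over `S` (obtained from `Y` by a `V`-admissible blowing up), an open `V' ⊆ Y'` containing `V`
(`sV : V → V'` with `sV ≫ (V' ↪ Y') = (V → Y')`) and a PROPER morphism `ψ : V' → U` over `S`
extending `j` (`sV ≫ ψ = j`), which moreover is an isomorphism over `j(V) ⊆ U`.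
[cite: StacksProject, Tag 0F3Z] -/
theorem stacks0F3Z_of_stacks081R (hRG : Stacks081R.{u}) {S U V Y : Scheme.{u}} [CompactSpace S]
    [QuasiSeparatedSpace S] (g : U ⟶ S) [IsSeparated g] [LocallyOfFiniteType g] [QuasiCompact g]
    (j : V ⟶ U) [IsOpenImmersion j] [QuasiCompact j] (jY : V ⟶ Y) [IsOpenImmersion jY]
    (πY : Y ⟶ S) [IsProper πY] (hcomm : jY ≫ πY = j ≫ g) :
    ∃ (Y' : Scheme.{u}) (jY' : V ⟶ Y') (πY' : Y' ⟶ S) (V' : Y'.Opens) (ψ : (V' : Scheme.{u}) ⟶ U)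
      (sV : V ⟶ V'), IsOpenImmersion jY' ∧ IsProper πY' ∧ jY' ≫ πY' = j ≫ g ∧ IsProper ψ ∧
      sV ≫ V'.ι = jY' ∧ sV ≫ ψ = j ∧ ψ ≫ g = V'.ι ≫ πY' ∧ IsIso (ψ ∣_ j.opensRange) := by
  /- quasi-compactness bookkeeping -/
  haveI : CompactSpace U := QuasiCompact.compactSpace_of_compactSpace g
  haveI : CompactSpace V := QuasiCompact.compactSpace_of_compactSpace j
  haveI : CompactSpace Y := QuasiCompact.compactSpace_of_compactSpace πY
  haveI : QuasiSeparatedSpace Y := quasiSeparatedSpace_of_quasiSeparated πY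
  haveI : QuasiSeparatedSpace U := quasiSeparatedSpace_of_quasiSeparated g
  /- the "diagonal" `γ : V → Y ×_S U` and its scheme-theoretic image `Z` -/
  set pr₁ := pullback.fst πY g with hpr₁
  set pr₂ := pullback.snd πY g with hpr₂
  set γ : V ⟶ pullback πY g := pullback.lift jY j hcomm with hγ
  have hγ₁ : γ ≫ pr₁ = jY := pullback.lift_fst _ _ _
  have hγ₂ : γ ≫ pr₂ = j := pullback.lift_snd _ _ _
  haveI : QuasiSeparatedSpace (↥(pullback πY g : Scheme.{u})) := quasiSeparatedSpace_of_quasiSeparated pr₂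
  haveI : QuasiCompact γ := inferInstance
  set Z := γ.image with hZ
  set ιZ := γ.imageι with hιZ
  set sZ := γ.toImage with hsZ
  set p : Z ⟶ Y := ιZ ≫ pr₁ with hp
  set r : Z ⟶ U := ιZ ≫ pr₂ with hr
  haveI : IsSeparated p := inferInstance
  haveI : LocallyOfFiniteType p := inferInstance
  haveI : QuasiCompact p := inferInstance
  haveI : IsProper r := inferInstance
  -- `Z → Y` is an isomorphism over `W = jY(V)`, `Z → U` over `j(V)`, both with preimage `sZ(V)`
  set W : Y.Opens := jY.opensRange with hW
  haveI hpW : IsIso (p ∣_ W) := GraphClosure.isIso_morphismRestrict jY pr₁ γ hγ₁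
  haveI hrV : IsIso (r ∣_ j.opensRange) := GraphClosure.isIso_morphismRestrict j pr₂ γ hγ₂
  have hrange₁ := (GraphClosure.isOpenImmersion_toImage_and_range jY pr₁ γ hγ₁).2
  have hrange₂ := (GraphClosure.isOpenImmersion_toImage_and_range j pr₂ γ hγ₂).2
  have hpre : r ⁻¹ᵁ j.opensRange = p ⁻¹ᵁ W := by
    apply Opens.ext
    exact hrange₂.symm.trans hrange₁
  have hWc : IsCompact (W : Set Y) := isCompact_range jY.continuous
  /- Stacks 081S: after a `W`-admissible blowing up `b : Y' → Y`, the strict transform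
    `c : Z' → Y'` of `Z → Y` is an open immersion -/
  obtain ⟨Q, Y', b, hQfg, hQsupp, hb, hopen⟩ := stacks081S_of_stacks081R hRG p W hWc
  have hcc : centreCompl Q = W := centreCompl_eq_of_support_eq hQsupp
  have hE : IsEffectiveCartier (Q.comap b) := hb.isEffectiveCartier
  haveI : IsProper b := IsBlowup.isProper_of_fg hQfg hb
  haveI hbW : IsIso (b ∣_ W) := by rw [← hcc]; exact hb.isIso_compl
  set c := blowupStrictTransformMap p b Q with hc
  haveI : IsOpenImmersion c := hopen
  set ιZ' := blowupStrictTransformι p b Q with hιZ'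
  set bZ : blowupStrictTransform p b Q ⟶ Z := ιZ' ≫ pullback.fst p b with hbZ
  haveI : IsProper bZ := inferInstance
  -- the open `V' = c(Z') ⊆ Y'` and `e : Z' ≅ V'`
  set V' : Y'.Opens := c.opensRange with hV'
  set e := c.isoOpensRange with he
  -- the new embedding `jY' : V → Y'` (through `b⁻¹(W) ≅ W ≅ V`)
  set jY' : V ⟶ Y' := jY.isoOpensRange.hom ≫ inv (b ∣_ W) ≫ (b ⁻¹ᵁ W).ι with hjY'
  have hjY'b : jY' ≫ b = jY := by
    rw [hjY', Category.assoc, Category.assoc, ← morphismRestrict_ι, IsIso.inv_hom_id_assoc,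
      Scheme.Hom.isoOpensRange_hom_ι]
  haveI : IsOpenImmersion jY' := by rw [hjY']; infer_instance
  -- `V → Z ×_Y Y'` lands in the open over `b⁻¹(W)`, where the strict transform is everything
  set t₀ : V ⟶ pullback p b := pullback.lift sZ jY' (by
    rw [hjY'b, hsZ, hp, Scheme.Hom.toImage_imageι_assoc, hγ₁]) with ht₀
  have ht₀range : Set.range t₀ ⊆
      Set.range ((pullback.snd p b) ⁻¹ᵁ (b ⁻¹ᵁ centreCompl Q)).ι := by
    rw [Scheme.Opens.range_ι]
    rintro _ ⟨v, rfl⟩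
    show b (pullback.snd p b (t₀ v)) ∈ centreCompl Q
    rw [← Scheme.Hom.comp_apply, ← Scheme.Hom.comp_apply, pullback.lift_snd_assoc, hjY'b, hcc]
    exact ⟨v, rfl⟩
  set t₁ := IsOpenImmersion.lift _ t₀ ht₀range with ht₁
  have ht₁ι : t₁ ≫ ((pullback.snd p b) ⁻¹ᵁ (b ⁻¹ᵁ centreCompl Q)).ι = t₀ :=
    IsOpenImmersion.lift_fac _ _ _
  set sZ' : V ⟶ blowupStrictTransform p b Q :=
    t₁ ≫ ((pullback.snd p b) ⁻¹ᵁ (b ⁻¹ᵁ centreCompl Q)).ι.toImage with hsZ'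
  have hsZ'ι : sZ' ≫ ιZ' = t₀ := by
    rw [hsZ', Category.assoc]
    change t₁ ≫ (((pullback.snd p b) ⁻¹ᵁ (b ⁻¹ᵁ centreCompl Q)).ι.toImage ≫
      ((pullback.snd p b) ⁻¹ᵁ (b ⁻¹ᵁ centreCompl Q)).ι.imageι) = t₀
    rw [Scheme.Hom.toImage_imageι, ht₁ι]
  have hsZ'c : sZ' ≫ c = jY' := by
    change sZ' ≫ ιZ' ≫ pullback.snd p b = jY'
    rw [← Category.assoc, hsZ'ι, ht₀, pullback.lift_snd]
  have hsZ'bZ : sZ' ≫ bZ = sZ := by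
    rw [hbZ, ← Category.assoc, hsZ'ι, ht₀, pullback.lift_fst]
  -- the data
  set sV : V ⟶ V' := sZ' ≫ e.hom with hsV
  set ψ : (V' : Scheme.{u}) ⟶ U := e.inv ≫ bZ ≫ r with hψ
  have heι : e.hom ≫ V'.ι = c := Scheme.Hom.isoOpensRange_hom_ι c
  have heinv : e.inv ≫ c = V'.ι := Scheme.Hom.isoOpensRange_inv_comp c
  refine ⟨Y', jY', b ≫ πY, V', ψ, sV, inferInstance, inferInstance, ?_, ?_, ?_, ?_, ?_, ?_⟩
  · rw [← Category.assoc, hjY'b, hcomm]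
  · rw [hψ]; infer_instance
  · rw [hsV, Category.assoc, heι, hsZ'c]
  · rw [hsV, hψ, Category.assoc, e.hom_inv_id_assoc, ← Category.assoc, hsZ'bZ, hsZ, hr,
      Scheme.Hom.toImage_imageι_assoc, hγ₂]
  · -- `ψ ≫ g = V'.ι ≫ b ≫ πY`
    have h1 : bZ ≫ r ≫ g = c ≫ b ≫ πY := by
      rw [hr, hbZ, hpr₂]
      simp only [Category.assoc]
      rw [← pullback.condition, ← hpr₁, ← Category.assoc ιZ pr₁ πY, ← hp,
        ← Category.assoc (pullback.fst p b) p πY, pullback.condition, Category.assoc, hc, hιZ']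
      change blowupStrictTransformι p b Q ≫ pullback.snd p b ≫ b ≫ πY =
        (blowupStrictTransformι p b Q ≫ pullback.snd p b) ≫ b ≫ πY
      rw [Category.assoc]
    rw [hψ, Category.assoc, Category.assoc, h1, ← Category.assoc, heinv]
  · -- `ψ` is an isomorphism over `j(V)`: `r` is, `bZ` is over `r⁻¹(j(V)) = p⁻¹(W)`, `e.inv` is
    haveI h2 : IsIso (bZ ∣_ r ⁻¹ᵁ j.opensRange) := by
      rw [hpre, hbZ]
      haveI : IsIso (pullback.fst p b ∣_ p ⁻¹ᵁ W) := isIso_morphismRestrict_pullback_fst p b W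
      haveI : IsIso (ιZ' ∣_ (pullback.fst p b) ⁻¹ᵁ (p ⁻¹ᵁ W)) := by
        have hO : (pullback.fst p b) ⁻¹ᵁ (p ⁻¹ᵁ W) =
            (pullback.snd p b) ⁻¹ᵁ (b ⁻¹ᵁ centreCompl Q) := by
          rw [← Scheme.Hom.comp_preimage, pullback.condition, Scheme.Hom.comp_preimage, hcc]
        rw [hO, hιZ']
        exact isIso_blowupStrictTransformι_morphismRestrict p b Q hE
      exact isIso_morphismRestrict_comp ιZ' (pullback.fst p b) (p ⁻¹ᵁ W)
    haveI h3 : IsIso (e.inv ∣_ (bZ ≫ r) ⁻¹ᵁ j.opensRange) :=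
      (MorphismProperty.isomorphisms.iff _).mp
        (IsZariskiLocalAtTarget.restrict ((MorphismProperty.isomorphisms.iff _).mpr inferInstance) _)
    haveI h4 : IsIso ((bZ ≫ r) ∣_ j.opensRange) := isIso_morphismRestrict_comp bZ r _
    rw [hψ]
    exact isIso_morphismRestrict_comp e.inv (bZ ≫ r) _

end Literature.AlgebraicGeometry.Morphisms

end
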